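import Mathlib

/-!
# SoloInformed — the polarised adjugate and the principal part of the scalar curvature

Soloist `solo-FinalStateConjecture-informed`, session 24 (2026-08-19). Kernel shadow of the ALGEBRA
behind "LEMMA D" of the soloist's tame-curve lemma (paper `TCL.md` §9′, edition E2.11), which is
used to glue asymptotically flat vacuum initial data across a collar WITHOUT losing a derivative.

Background (pen-and-paper, not formalised here). For a Riemannian `3`-metric `g` put
`𝔄 := det g · g⁻¹ = adj g` (the adjugate — a QUADRATIC polynomial in the entries of `g`). Then the
scalar curvature is in divergence form in `𝔄`,
`R(g) = -(det g)⁻¹ ∂_a∂_b 𝔄^{ab} + ½ (det g)⁻² (∂_a det g)(∂_b 𝔄^{ab}) + g^{ik}(Γ^m_{il}Γ^l_{km} - Γ^l_{ik}Γ^m_{lm})`,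
which is Landau–Lifshitz, *The Classical Theory of Fields*, §93 (`√g R = ∂_l(√g g^{ik}Γ^l_{ik}) -
∂_k(√g g^{ik}Γ^l_{il}) + √g G`, eq. (93.3)) combined with the one-line identity
`√g (g^{ik}Γ^l_{ik} - g^{lk}Γ^m_{km}) = -(det g)^{-1/2} ∂_k(det g · g^{lk})`; likewise
`√g (div_g π)^b = ∂_a 𝔭^{ab} + Γ^b_{ac} 𝔭^{ac}` for `𝔭 := √g π^{♯♯}`. Consequently an
interpolation `adj ĝ := χ adj g₀ + (1-χ) adj g₁`, `𝔭̂ := χ 𝔭₀ + (1-χ) 𝔭₁` of two solutions of the vacuum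
constraints has a constraint defect containing NO second derivatives of `g₀, g₁` and NO derivatives
of `π₀, π₁` (they enter only through the constraints of the pieces, which vanish) — whereas
interpolating `(g, π)` themselves leaves a defect `∼ χ(χ-1)·(quadratic in g₁-g₀)·∂²(g₁-g₀)`, one
derivative worse. This is what removes the logarithmic Calderón–Zygmund loss from the soloist's
earlier collar estimate.

What this file certifies (pure matrix algebra, `3 × 3`, any commutative ring resp. field):

* `adjPolar A τ := adj (A + τ) - adj A - adj τ`, the polarisation of the quadratic map `adj`, is
  symmetric and additive in `τ` with `adjPolar A A = 2 • adj A` (`adjPolar_comm`, `adjPolar_add_right`,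
  `adjPolar_self`) — i.e. `adj` is a quadratic form with polar form `adjPolar`, so by the chain rule
  `∂_a∂_b (adj g) = adjPolar g (∂_a∂_b g) + adjPolar (∂_a g) (∂_b g)`: the second derivatives of `g`
  enter `∂∂ adj g` only through `adjPolar g (∂_a∂_b g)`.
* `det_smul_adjPolar`: the polynomial identity `det A • adjPolar A τ = tr(adj A · τ) • adj A - adj A · τ · adj A`
  (for invertible `A` with `Q = A⁻¹`: `adjPolar A τ = det A • (tr(Qτ) • Q - Q τ Q)`,
  `adjPolar_eq_of_mul_eq_one` — the familiar `δ(det g · g⁻¹) = det g (g^{cd}δg_{cd} g⁻¹ - g⁻¹ δg g⁻¹)`).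
* `sum_adjPolar_hessian`: contracting with a family of "Hessians" `C a b` (the matrices
  `(∂_a∂_b g_{cd})_{cd}`), `Σ_{ab} (adjPolar A (C a b))_{ab} = -det A · Π_Q(C)` where
  `Π_Q(C) = Σ Q_{ab} Q_{cd} (C_{ac,bd} - C_{ab,cd})` (`princScal`) is the principal part
  `g^{ab}g^{cd}(∂_a∂_c g_{bd} - ∂_a∂_b g_{cd})` of the scalar curvature. So the `∂²g`-content of
  `-(det g)⁻¹ ∂_a∂_b (adj g)^{ab}` is exactly that of `R(g)`, which is the second-order half of LEMMA D.

References: L. D. Landau, E. M. Lifshitz, *The Classical Theory of Fields*, 4th ed., §93 and §96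
(eqs. (96.2)–(96.3), the superpotential form); the divergence identity for `adj g` is folklore-level
and is claimed here only as correctly stated and machine-checked in its algebraic part.
-/

set_option linter.dupNamespace false

namespace Summit.FinalStateConjecture.FinalStateConjecture.Theorems

open Matrix

variable {R : Type*} [CommRing R]

/-- Polarisation of the adjugate of `3 × 3` matrices: `adjPolar A τ = adj (A + τ) - adj A - adj τ`.
Since `adj` is quadratic for `3 × 3` matrices, this is its polar bilinear form, i.e. the derivative
`D adj_A (τ)`. -/
def adjPolar (A τ : Matrix (Fin 3) (Fin 3) R) : Matrix (Fin 3) (Fin 3) R :=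
  (A + τ).adjugate - A.adjugate - τ.adjugate

/-- `adjPolar` is symmetric: `adj (A + τ) - adj A - adj τ` is symmetric in `(A, τ)`. -/
theorem adjPolar_comm (A τ : Matrix (Fin 3) (Fin 3) R) : adjPolar A τ = adjPolar τ A := by
  unfold adjPolar
  rw [add_comm A τ]
  abel

/-- `adjPolar` is additive in its second argument: `adj` has degree `≤ 2`. -/
theorem adjPolar_add_right (A τ₁ τ₂ : Matrix (Fin 3) (Fin 3) R) :
    adjPolar A (τ₁ + τ₂) = adjPolar A τ₁ + adjPolar A τ₂ := by
  ext i j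
  simp only [adjPolar, Matrix.adjugate_fin_three, Matrix.sub_apply, Matrix.add_apply,
    Matrix.of_apply]
  fin_cases i <;> fin_cases j <;> simp <;> ring

/-- `adjPolar A A = 2 • adj A`: `adj` is homogeneous of degree `2` (Euler's identity for the
quadratic form `adj`). -/
theorem adjPolar_self (A : Matrix (Fin 3) (Fin 3) R) : adjPolar A A = 2 • A.adjugate := by
  ext i j
  simp only [adjPolar, Matrix.adjugate_fin_three, Matrix.sub_apply, Matrix.add_apply,
    Matrix.of_apply, Matrix.smul_apply, nsmul_eq_mul, Nat.cast_ofNat]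
  fin_cases i <;> fin_cases j <;> simp <;> ring

/-- The polarised-adjugate identity (a polynomial identity in the `18` entries of `A, τ`, valid
over any commutative ring):
`det A • (adj (A + τ) - adj A - adj τ) = tr(adj A · τ) • adj A - adj A · τ · adj A`. -/
theorem det_smul_adjPolar (A τ : Matrix (Fin 3) (Fin 3) R) :
    A.det • adjPolar A τ = (A.adjugate * τ).trace • A.adjugate - A.adjugate * τ * A.adjugate := by
  ext i j
  simp only [adjPolar, Matrix.adjugate_fin_three, Matrix.det_fin_three, Matrix.trace, Matrix.diag,
    Matrix.mul_apply, Fin.sum_univ_three, Matrix.smul_apply, Matrix.sub_apply, Matrix.add_apply,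
    Matrix.of_apply, smul_eq_mul]
  fin_cases i <;> fin_cases j <;> simp <;> ring

/-- If `A * Q = 1` then `adj A = det A • Q` (any size, any commutative ring). -/
theorem adjugate_eq_det_smul_of_mul_eq_one {n : Type*} [Fintype n] [DecidableEq n]
    {A Q : Matrix n n R} (h : A * Q = 1) : A.adjugate = A.det • Q := by
  have hQA : Q * A = 1 := mul_eq_one_comm.mp h
  calc A.adjugate = (Q * A) * A.adjugate := by rw [hQA, Matrix.one_mul]
    _ = Q * (A * A.adjugate) := by rw [Matrix.mul_assoc]
    _ = A.det • Q := by rw [Matrix.mul_adjugate, Matrix.mul_smul, Matrix.mul_one]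

variable {K : Type*} [Field K]

/-- Over a field, with `Q = A⁻¹`: `adj (A + τ) - adj A - adj τ = det A • (tr(Q τ) • Q - Q τ Q)`.
For a Riemannian metric `g = A`, `Q = g⁻¹`, this is the classical variation formula
`δ(det g · g⁻¹) = det g · ((g^{cd} δg_{cd}) g⁻¹ - g⁻¹ (δg) g⁻¹)`. -/
theorem adjPolar_eq_of_mul_eq_one {A Q : Matrix (Fin 3) (Fin 3) K} (h : A * Q = 1)
    (τ : Matrix (Fin 3) (Fin 3) K) :
    adjPolar A τ = A.det • ((Q * τ).trace • Q - Q * τ * Q) := by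
  have hdet : A.det ≠ 0 := by
    intro h0
    have := congrArg Matrix.det h
    rw [Matrix.det_mul, Matrix.det_one, h0, zero_mul] at this
    exact zero_ne_one this
  have hadj : A.adjugate = A.det • Q := adjugate_eq_det_smul_of_mul_eq_one h
  have key : A.det • adjPolar A τ = A.det • (A.det • ((Q * τ).trace • Q - Q * τ * Q)) := by
    rw [det_smul_adjPolar, hadj]
    ext i j
    simp only [Matrix.trace, Matrix.diag, Matrix.mul_apply, Fin.sum_univ_three, Matrix.smul_apply,
      Matrix.sub_apply, smul_eq_mul]
    ring
  calc adjPolar A τ = A.det⁻¹ • (A.det • adjPolar A τ) := (inv_smul_smul₀ hdet _).symm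
    _ = A.det • ((Q * τ).trace • Q - Q * τ * Q) := by rw [key, inv_smul_smul₀ hdet]

/-- The principal part of the scalar curvature as a function of the inverse metric `Q = g⁻¹` and of
the family `C a c = (∂_a∂_c g_{bd})_{bd}` of second derivatives:
`Π_Q(C) = Σ_{abcd} Q_{ab} Q_{cd} (∂_a∂_c g_{bd} - ∂_a∂_b g_{cd})`
(so that `R(g) = Π_{g⁻¹}(∂²g) + (terms quadratic in ∂g)`). -/
def princScal (Q : Matrix (Fin 3) (Fin 3) R) (C : Fin 3 → Fin 3 → Matrix (Fin 3) (Fin 3) R) : R :=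
  ∑ a, ∑ b, ∑ c, ∑ d, Q a b * Q c d * (C a c b d - C a b c d)

/-- LEMMA D, second-order part: the double divergence of the linearised adjugate is `-det g` times
the principal part of the scalar curvature. For `A * Q = 1`, `Q` symmetric, and any family `C`:
`Σ_{ab} (adj-polarisation of A against C a b)_{ab} = -(det A · Π_Q(C))`. Reading `A = g(x)`,
`C a b = ∂_a∂_b g(x)`: the `∂²g`-terms of `∂_a∂_b (adj g)^{ab}` are `-det g · (∂²g-terms of R(g))`. -/
theorem sum_adjPolar_hessian {A Q : Matrix (Fin 3) (Fin 3) K} (h : A * Q = 1) (hQ : Q.IsSymm)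
    (C : Fin 3 → Fin 3 → Matrix (Fin 3) (Fin 3) K) :
    ∑ a, ∑ b, adjPolar A (C a b) a b = -(A.det * princScal Q C) := by
  have hs : ∀ i j, Q j i = Q i j := fun i j => hQ.apply i j
  have h10 : Q 1 0 = Q 0 1 := hs 0 1
  have h20 : Q 2 0 = Q 0 2 := hs 0 2
  have h21 : Q 2 1 = Q 1 2 := hs 1 2
  simp only [adjPolar_eq_of_mul_eq_one h, princScal, Fin.sum_univ_three, Matrix.trace, Matrix.diag,
    Matrix.mul_apply, Matrix.smul_apply, Matrix.sub_apply, smul_eq_mul, h10, h20, h21]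
  ring

end Summit.FinalStateConjecture.FinalStateConjecture.Theorems
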